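import Summits.QuantumFields.QCD.Theorems.ExtinctionBuildsQCD.Negative.ExtinctIntegrable
import Summits.QuantumFields.QCD.Theorems.TipPricing.Negative.ReflectionSignedTight

/-!
# `WindowExtinction` (crux stmt-QuantumFields-18063, SD⁺) — negative-side support:
# TIGHT⁺ is a ONE-SIDED statement — the deficit tail `(6N⁴ − n₋)⁺` alone carries half the extensive floor

Standing crux disprover of the hinge (cdisprove seat on the RESTATED crux, 2026-08-17), certified copy of §11d of
`Summits/QuantumFields/QCD/Cruxes/WindowExtinction/Disproof.lean`.  Sorry-free, no definitions, asserts no route item.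
Built on the landed time-reflection antisymmetry of the signed index
(`TipPricing/Negative/ReflectionSignedTight.signedIndex_integral_nonpos`: `∫ (n₋ − 6S⁴)·W dμ_β ≤ 0` for every torus,
coupling, probe and weight tuple) and the count measurability / integrability toolkit of
`ExtinctionBuildsQCD/Negative/ExtinctIntegrable.lean`.

* `abs_eq_self_add_two_mul_negPart` — `|q| = q + 2·max 0 (−q)` on `ℝ`.
* `absIndex_integral_le_two_mul_deficit_integral` — on every torus `S⁴`:
  `∫ |n₋(Γ₅D_W(U,m',1)) − 6S⁴|·W ≤ 2 ∫ max 0 (6S⁴ − n₋(Γ₅D_W(U,m',1)))·W` for the phase-quenched weight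
  `W = ∏_f |det D_W(U, mq_f, 1)|` (identity above + reflection antisymmetry; both integrands integrable).
* `tightRatio_le_two_mul_deficitRatio`, `eventually_half_floor_le_deficitRatio` — hence for witness data satisfying the
  TIGHT⁺ clause of SD⁺ (stated verbatim as a hypothesis): for every `M > M₀`, eventually in `k`,
  `max 1 (η (a_k(2L_k+1))²) / 2 ≤ E₊[ max 0 (6(2L_k+1)⁴ − n₋(Γ₅D_W(U, m_crit(k) − a_kM/Z_k, 1))) ]`.
  READING: the modulus in TIGHT⁺ hides no cancellation budget — up to the factor `2` the clause is the ONE-SIDED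
  anti-concentration statement "the phase-quenched mean DEFICIT of negative levels of `H_W` just below the line is
  `≳ η√V_phys`"; symmetrically (reflection) the excess tail carries the other half up to the zero-level atom.  A
  prover may therefore aim at a single tail; a refuter at bounding ONE tail by `o((a_k L_k)²)`.

References: Osterwalder–Seiler, Ann. Phys. 110 (1978) 440 (time reflection); Leutwyler–Smilga, Phys. Rev. D 46 (1992)
5607 (the `√(χ_t V)` scale).
-/

noncomputable section

namespace Summit.QuantumFields.QCD.Theorems.WindowExtinction.Negative

open scoped BigOperators Topology Classical MeasureTheory Matrix ComplexConjugate
open Filter MeasureTheory Matrix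
open Literature.MathematicalPhysics.QuantumLattice Literature.MathematicalPhysics.QuantumFieldTheory
  Literature.Probability.LatticeModels
open Summit.QuantumFields.QCD.Theses.SpectralDefectExtinction
open Summit.QuantumFields.QCD.Theorems.ExtinctionBuildsQCD.Negative
open Summit.QuantumFields.QCD.Theorems.TipPricing.Negative

section OneSided

variable {Nf : ℕ}

/-- `|q| = q + 2·max 0 (−q)` on `ℝ`. -/
theorem abs_eq_self_add_two_mul_negPart (q : ℝ) : |q| = q + 2 * max 0 (-q) := by
  rcases le_or_gt 0 q with h | h
  · rw [abs_of_nonneg h, max_eq_left (by linarith)]; ring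
  · rw [abs_of_neg h, max_eq_right (by linarith)]; ring

/-- **`∫ |index|·W ≤ 2 ∫ (deficit)·W` on every torus.** For every torus side `S`, coupling `β`, probe mass `m'` and
weight tuple `mq`: the phase-quenched (un-normalised) mean of `|n₋(Γ₅D_W(U,m',1)) − 6S⁴|` is at most twice that of the
DEFICIT `max 0 (6S⁴ − n₋(Γ₅D_W(U,m',1)))` — `|q| = q + 2q⁻` and the signed mean is `≤ 0` by time reflection. -/
theorem absIndex_integral_le_two_mul_deficit_integral (S : ℕ) [NeZero S] (β m' : ℝ) (mq : Fin Nf → ℝ) :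
    ∫ U, |(Multiset.countP (fun z : ℂ => z.re < 0) (spinorLift gammaFive * wilsonDirac (fundamentalRep (Fin 3)) U m' 1).charpoly.roots : ℝ) - 6 * (S : ℝ) ^ 4| *
        ∏ f : Fin Nf, ‖fermionDet (wilsonDirac (fundamentalRep (Fin 3)) U (mq f) 1)‖
      ∂(wilsonMeasure (d := 4) (L := S) (fundamentalRep (Fin 3)) β) ≤
    2 * ∫ U, max 0 (6 * (S : ℝ) ^ 4 - (Multiset.countP (fun z : ℂ => z.re < 0) (spinorLift gammaFive * wilsonDirac (fundamentalRep (Fin 3)) U m' 1).charpoly.roots : ℝ)) *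
        ∏ f : Fin Nf, ‖fermionDet (wilsonDirac (fundamentalRep (Fin 3)) U (mq f) 1)‖
      ∂(wilsonMeasure (d := 4) (L := S) (fundamentalRep (Fin 3)) β) := by
  set μ := wilsonMeasure (d := 4) (L := S) (fundamentalRep (Fin 3)) β with hμ
  -- the three integrands
  set q : GaugeConfig 4 S (Matrix.specialUnitaryGroup (Fin 3) ℂ) → ℝ := fun U =>
    (Multiset.countP (fun z : ℂ => z.re < 0) (spinorLift gammaFive * wilsonDirac (fundamentalRep (Fin 3)) U m' 1).charpoly.roots : ℝ) - 6 * (S : ℝ) ^ 4 with hq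
  set W : GaugeConfig 4 S (Matrix.specialUnitaryGroup (Fin 3) ℂ) → ℝ := fun U =>
    ∏ f : Fin Nf, ‖fermionDet (wilsonDirac (fundamentalRep (Fin 3)) U (mq f) 1)‖ with hW
  have hmeas_q : Measurable q :=
    (measurable_from_nat.comp (measurable_negCount (L := S) m')).sub measurable_const
  have hbound : ∀ U, |q U| ≤ 6 * (S : ℝ) ^ 4 := by
    intro U
    have hle : (Multiset.countP (fun z : ℂ => z.re < 0) (spinorLift gammaFive * wilsonDirac (fundamentalRep (Fin 3)) U m' 1).charpoly.roots : ℝ) ≤ 12 * (S : ℝ) ^ 4 := by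
      have := countP_roots_charpoly_le_card (spinorLift gammaFive * wilsonDirac (fundamentalRep (Fin 3)) U m' 1)
        (fun z : ℂ => z.re < 0)
      rw [card_quarkIdx] at this
      exact_mod_cast this
    have h0 : (0 : ℝ) ≤ (Multiset.countP (fun z : ℂ => z.re < 0) (spinorLift gammaFive * wilsonDirac (fundamentalRep (Fin 3)) U m' 1).charpoly.roots : ℝ) :=
      Nat.cast_nonneg _
    rw [hq, abs_le]
    constructor <;> simp only <;> linarith
  have hint_q : Integrable (fun U => q U * W U) μ :=
    integrable_mul_weight mq β hmeas_q hbound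
  have hint_neg : Integrable (fun U => max 0 (-q U) * W U) μ := by
    refine integrable_mul_weight mq β (measurable_const.max hmeas_q.neg) (C := 6 * (S : ℝ) ^ 4) fun U => ?_
    have := hbound U
    rw [abs_le] at this ⊢
    constructor
    · linarith [le_max_left 0 (-q U)]
    · rcases le_or_gt 0 (-q U) with h | h
      · rw [max_eq_right h]; linarith
      · rw [max_eq_left h.le]; positivity
  -- `|q| W = q W + 2 (q⁻ W)` pointwise
  have hsplit : ∀ U, |q U| * W U = q U * W U + 2 * (max 0 (-q U) * W U) := by
    intro U; rw [abs_eq_self_add_two_mul_negPart]; ring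
  have hsigned : ∫ U, q U * W U ∂μ ≤ 0 := signedIndex_integral_nonpos (Nf := Nf) S β m' mq
  have hdef : ∀ U, max 0 (6 * (S : ℝ) ^ 4 - (Multiset.countP (fun z : ℂ => z.re < 0) (spinorLift gammaFive * wilsonDirac (fundamentalRep (Fin 3)) U m' 1).charpoly.roots : ℝ)) = max 0 (-q U) := by
    intro U; rw [hq]; ring_nf
  calc ∫ U, |q U| * W U ∂μ = ∫ U, (q U * W U + 2 * (max 0 (-q U) * W U)) ∂μ := integral_congr_ae (ae_of_all _ hsplit)
    _ = ∫ U, q U * W U ∂μ + 2 * ∫ U, max 0 (-q U) * W U ∂μ := by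
        rw [integral_add hint_q (hint_neg.const_mul 2), integral_const_mul]
    _ ≤ 2 * ∫ U, max 0 (-q U) * W U ∂μ := by linarith
    _ = _ := by
        congr 1
        refine integral_congr_ae (ae_of_all _ fun U => ?_)
        beta_reduce
        rw [hdef U]

/-- **The TIGHT⁺ ratio is at most twice the deficit ratio** (scheme torus `(2L_k+1)⁴`, any witness data, probe `M`, tuple
`m`, step `k`). -/
theorem tightRatio_le_two_mul_deficitRatio (reg : QCDRegularisation Nf) (m : Fin Nf → ℝ) (M : ℝ) (k : ℕ) :
    (∫ U, (|(Multiset.countP (fun z : ℂ => z.re < 0) (spinorLift gammaFive * wilsonDirac (fundamentalRep (Fin 3)) U (reg.mcrit k - reg.a k * M / reg.Zm k) 1).charpoly.roots : ℝ) - 6 * (2 * reg.L k + 1 : ℝ) ^ 4|) * ∏ f : Fin Nf, ‖fermionDet (wilsonDirac (fundamentalRep (Fin 3)) U (reg.mcrit k + reg.a k * m f / reg.Zm k) 1)‖ ∂(wilsonMeasure (d := 4) (L := 2 * reg.L k + 1) (fundamentalRep (Fin 3)) (reg.β k))) / (∫ U, ∏ f : Fin Nf, ‖fermionDet (wilsonDirac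 (fundamentalRep (Fin 3)) U (reg.mcrit k + reg.a k * m f / reg.Zm k) 1)‖ ∂(wilsonMeasure (d := 4) (L := 2 * reg.L k + 1) (fundamentalRep (Fin 3)) (reg.β k))) ≤
    2 * ((∫ U, max 0 (6 * (2 * reg.L k + 1 : ℝ) ^ 4 - (Multiset.countP (fun z : ℂ => z.re < 0) (spinorLift gammaFive * wilsonDirac (fundamentalRep (Fin 3)) U (reg.mcrit k - reg.a k * M / reg.Zm k) 1).charpoly.roots : ℝ)) * ∏ f : Fin Nf, ‖fermionDet (wilsonDirac (fundamentalRep (Fin 3)) U (reg.mcrit k + reg.a k * m f / reg.Zm k) 1)‖ ∂(wilsonMeasure (d := 4) (L := 2 * reg.L k + 1) (fundamentalRep (Fin 3)) (reg.β k))) / (∫ U, ∏ f : Fin Nf, ‖fermionDet (wilsonDirac (fundamentalRep (Fin 3)) U (reg.mcrit k + reg.a k * m f / reg.Zm k) 1)‖ ∂(wilsonMeasure (d := 4) (L := 2 * reg.L k + 1) (fundamentalRep (Fin 3)) (reg.β k)))) := by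
  have h := absIndex_integral_le_two_mul_deficit_integral (Nf := Nf) (2 * reg.L k + 1) (reg.β k)
    (reg.mcrit k - reg.a k * M / reg.Zm k) (fun f => reg.mcrit k + reg.a k * m f / reg.Zm k)
  have hcast : ((2 * reg.L k + 1 : ℕ) : ℝ) = 2 * reg.L k + 1 := by push_cast; ring
  rw [hcast] at h
  have hden : 0 ≤ ∫ U, ∏ f : Fin Nf, ‖fermionDet (wilsonDirac (fundamentalRep (Fin 3)) U
      (reg.mcrit k + reg.a k * m f / reg.Zm k) 1)‖
        ∂(wilsonMeasure (d := 4) (L := 2 * reg.L k + 1) (fundamentalRep (Fin 3)) (reg.β k)) :=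
    integral_nonneg fun _ => Finset.prod_nonneg fun _ _ => norm_nonneg _
  rw [mul_div_assoc']
  exact div_le_div_of_nonneg_right h hden

/-- **TIGHT⁺ ⇒ the DEFICIT TAIL alone is extensive.** For witness data `(reg, M₀)` and a tuple `m` satisfying the TIGHT⁺
clause of SD⁺ (verbatim, as a hypothesis): for every `M > M₀`, eventually in `k`,
`max 1 (η (a_k(2L_k+1))²) / 2 ≤ E₊[ max 0 (6(2L_k+1)⁴ − n₋(Γ₅D_W(U, m_crit(k) − a_kM/Z_k, 1))) ]` on the scheme torus. -/
theorem eventually_half_floor_le_deficitRatio (reg : QCDRegularisation Nf) {M₀ : ℝ} (m : Fin Nf → ℝ) {η : ℝ}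
    (hT : ∀ M : ℝ, M₀ < M → ∀ᶠ k : ℕ in Filter.atTop, max 1 (η * (reg.a k * (2 * reg.L k + 1 : ℝ)) ^ 2) ≤ (∫ U, (|(Multiset.countP (fun z : ℂ => z.re < 0) (spinorLift gammaFive * wilsonDirac (fundamentalRep (Fin 3)) U (reg.mcrit k - reg.a k * M / reg.Zm k) 1).charpoly.roots : ℝ) - 6 * (2 * reg.L k + 1 : ℝ) ^ 4|) * ∏ f : Fin Nf, ‖fermionDet (wilsonDirac (fundamentalRep (Fin 3)) U (reg.mcrit k + reg.a k * m f / reg.Zm k) 1)‖ ∂(wilsonMeasure (d := 4) (L := 2 * reg.L k + 1) (fundamentalRep (Fin 3)) (reg.β k))) / (∫ U, ∏ f : Fin Nf, ‖fermionDet (wilsonDirac (fundamentalRep (Fin 3)) U (reg.mcrit k + reg.a k * m f / reg.Zm k) 1)‖ ∂(wilsonMeasure (d := 4) (L := 2 * reg.L k + 1) (fundamentalRep (Fin 3)) (reg.β k))))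
    {M : ℝ} (hM : M₀ < M) :
    ∀ᶠ k : ℕ in Filter.atTop, max 1 (η * (reg.a k * (2 * reg.L k + 1 : ℝ)) ^ 2) / 2 ≤
      (∫ U, max 0 (6 * (2 * reg.L k + 1 : ℝ) ^ 4 - (Multiset.countP (fun z : ℂ => z.re < 0) (spinorLift gammaFive * wilsonDirac (fundamentalRep (Fin 3)) U (reg.mcrit k - reg.a k * M / reg.Zm k) 1).charpoly.roots : ℝ)) * ∏ f : Fin Nf, ‖fermionDet (wilsonDirac (fundamentalRep (Fin 3)) U (reg.mcrit k + reg.a k * m f / reg.Zm k) 1)‖ ∂(wilsonMeasure (d := 4) (L := 2 * reg.L k + 1) (fundamentalRep (Fin 3)) (reg.β k))) / (∫ U, ∏ f : Fin Nf, ‖fermionDet (wilsonDirac (fundamentalRep (Fin 3)) U (reg.mcrit k + reg.a k * m f / reg.Zm k) 1)‖ ∂(wilsonMeasure (d := 4) (L := 2 * reg.L k + 1) (fundamentalRep (Fin 3)) (reg.β k))) := by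
  filter_upwards [hT M hM] with k hk
  have h2 := tightRatio_le_two_mul_deficitRatio reg m M k
  linarith

/-- **Crux-level reading.** `WindowExtinction` (SD⁺) hands, at `N_f ∈ {2,3}`, a regularisation `reg` and `M₀ ≥ 0` such that
for every tuple `m` above `M₀` some `η > 0` has: for every `M > M₀`, eventually in `k`, the phase-quenched mean DEFICIT of
negative levels of `Γ₅D_W` at the probe `m_crit(k) − a_kM/Z_k` is at least `max 1 (η (a_k(2L_k+1))²) / 2`. -/
theorem deficit_of_windowExtinction (h : WindowExtinction) {Nf : ℕ} (hNf : Nf = 2 ∨ Nf = 3) :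
    ∃ reg : QCDRegularisation Nf, ∃ M₀ : ℝ, 0 ≤ M₀ ∧ ∀ m : Fin Nf → ℝ, (∀ f, M₀ < m f) → ∃ η : ℝ, 0 < η ∧
      ∀ M : ℝ, M₀ < M → ∀ᶠ k : ℕ in Filter.atTop, max 1 (η * (reg.a k * (2 * reg.L k + 1 : ℝ)) ^ 2) / 2 ≤
        (∫ U, max 0 (6 * (2 * reg.L k + 1 : ℝ) ^ 4 - (Multiset.countP (fun z : ℂ => z.re < 0) (spinorLift gammaFive * wilsonDirac (fundamentalRep (Fin 3)) U (reg.mcrit k - reg.a k * M / reg.Zm k) 1).charpoly.roots : ℝ)) * ∏ f : Fin Nf, ‖fermionDet (wilsonDirac (fundamentalRep (Fin 3)) U (reg.mcrit k + reg.a k * m f / reg.Zm k) 1)‖ ∂(wilsonMeasure (d := 4) (L := 2 * reg.L k + 1) (fundamentalRep (Fin 3)) (reg.β k))) / (∫ U, ∏ f : Fin Nf, ‖fermionDet (wilsonDirac (fundamentalRep (Fin 3)) U (reg.mcrit k + reg.a k * m f / reg.Zm k) 1)‖ ∂(wilsonMeasure (d := 4) (L := 2 * reg.L k + 1) (fundamentalRep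 (Fin 3)) (reg.β k))) := by
  obtain ⟨reg, -, -, -, -, M₀, hM₀, c, -, h⟩ := h Nf hNf
  refine ⟨reg, M₀, hM₀, fun m hm => ?_⟩
  obtain ⟨-, η, hη, hT⟩ := h m hm
  exact ⟨η, hη, fun M hM => eventually_half_floor_le_deficitRatio reg m hT hM⟩

end OneSided

end Summit.QuantumFields.QCD.Theorems.WindowExtinction.Negative

end
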